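import Mathlib
import HarnessLib
import Literature.Probability.MarkovChains.HeatKernelVarianceDecay
import Literature.Probability.MarkovChains.LogSobolevElementaryBounds
import Literature.Probability.MarkovChains.ModifiedLogSobolevConstant

/-!
# Convergence to stationarity along `P_t = e^{−t(I−P)}`: `Var_π(f_t) ≤ e^{−2λ₁t}Var_π(f_0)` and `D(μ_t‖π) ≤ e^{−2ρ₀t}D(μ_0‖π)` (Bobkov–Tetali 2006, §2: Lemma 2.1, Theorem 2.2, Lemma 2.3, Theorem 2.4, Corollary 2.8)

HONEST FRAMING: exact (Metropolis-corrected) sampling algorithms for lattice gauge theory; figures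
of merit are autocorrelation/cost numbers at stated couplings and volumes; no continuum-physics claim.

Source READ: S. G. Bobkov, P. Tetali, *Modified logarithmic Sobolev inequalities in discrete
settings*, J. Theoret. Probab. 19 (2006) 289–336 [BobkovTetali2006], §1 eqs. (1.1)–(1.6) and §2
"Convergence to stationarity" (pp. 292–296 of the hub literature service's copy): "we start with a
stochastic matrix `P` on a finite set `M`, and define a Markov process `{X_t}_{t ≥ 0}` in `M` with
initial distribution, say, `μ_0` and transition matrices `P_t = e^{−t(I−P)}`, `t ≥ 0`, with the
generator `−L = I − P`"; assumptions (a) `πP = π`, (b) `π(x) > 0`, (c) irreducibility; `μ_t = μ_0P_t`,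
`f_t = dμ_t/dπ`; LEMMA 2.1 `df_t(x)/dt = L^*f_t(x)` (`P^*` the time reversal, `−L^* = I − P^*`);
eq. (1.3) `(d/dt)Var_π(f_t) = −2𝓔(f_t,f_t)` and THEOREM 2.2 `Var_π(f_t) ≤ Var_π(f_0)e^{−2λ₁t}`;
LEMMA 2.3 "for any `μ_0` and all `t > 0`, the density `f_t` is strictly positive on `M`.  Furthermore,
the function `t → D(μ_t‖π)` is differentiable on `(0,+∞)`, and `(d/dt)D(μ_t‖π) = −𝓔(f_t, log f_t)`";
THEOREM 2.4 `D(μ_t‖π) ≤ D(μ_0‖π)e^{−2ρ₀t}` for the constant `ρ₀` of (1.5) `ρ₀Ent_π(f) ≤ ½𝓔(f, log f)`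
("Note that we did not make the assumption of reversibility", Remark 2.5); (2.4)
`‖μ_t − π‖²_TV ≤ (1/π_*)e^{−2λ₁t}`, (2.5) `‖μ_t − π‖²_TV ≤ 2D(μ_t‖π)` and COROLLARY 2.8
`‖μ_t − π‖²_TV ≤ 2 log(1/π_*) e^{−2ρ₀t}` — in the paper's norm `‖μ − π‖_TV = Σ_x|μ(x) − π(x)|`
(p. 290), i.e. TWICE the tree's `tvDist`.

Conventions.  `HeatKernelVarianceDecay.lean`: `heatKernel P r t = e^{rt(P−I)}` (Levin–Peres–Wilmer
(20.6)); the paper's `P_t` is `heatKernel P 1 t`, and `lawFlow P μ_0 t = μ_t = μ_0P_t` (a ROW vector,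
the tree's `stepLaw`), `densityFlow P π μ_0 t = f_t = μ_t/π`.  `PeskunOrdering.lean`:
`piInner π g h = ⟨g,h⟩_π`, `dirichletForm π P f = 𝓔(f,f) = ½Σ_{x,y}π(x)P(x,y)(f(x) − f(y))²`
(`= ⟨f,(I−P)f⟩_π` for a stationary `π`, `dirichletForm_eq`), `spectralGapR π P = λ₁` (the optimal
constant of (1.2) `λ₁Var_π(f) ≤ 𝓔(f,f)`: `spectralGapR_mul_lawVariance_le'`), `IsIrreducible`;
`LogSobolevConstant.lean`: `relEnt m π = D(m‖π) = Σ_x m(x)log(m(x)/π(x))` and Pinsker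
`two_mul_tvDist_sq_le_relEnt` (= (2.5)); `ModifiedLogSobolevConstant.lean`: `piEnt π f = Ent_π(f)`,
`entropyDirichletForm π P f` = the SYMMETRIC form `½Σ_{x,y}π(x)P(x,y)(f(x) − f(y))(log f(x) − log f(y))`,
`modLogSobolevConst π P = ρ₀`.  The paper's bilinear Dirichlet form (1.1) `𝓔(f,g) = −E_π(f·Lg)
= ⟨f,g⟩_π − ⟨f,Pg⟩_π` is `bilinDirichletForm π P f g` below; `𝓔(f,f)` is the tree's `dirichletForm`
(`bilinDirichletForm_self`) and, for a REVERSIBLE `P`, `𝓔(f, log f)` is the tree's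
`entropyDirichletForm` (`bilinDirichletForm_log_eq_entropyDirichletForm`); without reversibility the
symmetric form is the average `½(𝓔(f, log f) + 𝓔(log f, f))` (`entropyDirichletForm_eq_half_add`).
The FUNCTION side `H_tf` (Levin–Peres–Wilmer Lemma 20.5 / Theorem 20.6, reversible `P`) is
`HeatKernelVarianceDecay.lean`; this file is the LAW side `μ_0P_t` and the entropy, for a general
(non-reversible) `P`.

* `rateGenerator_one_apply`, `heatKernel_time_zero`, `hasDerivAt_heatKernel_forward` (the forward
  equation `P_t' = P_t(P − I)`), `heatKernel_pos` (all entries of `P_t` are positive for `t > 0` when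
  `P` is irreducible), `lawFlow`, `densityFlow` [cite: BobkovTetali2006, §2 (setting, p. 293)];
* **LEMMA 2.1** `hasDerivAt_lawFlow` (`dμ_t(y)/dt = (μ_tP)(y) − μ_t(y) = (μ_tL)(y)`),
  `BobkovTetali2006_lemma_2_1` (`df_t(x)/dt = (P^*f_t)(x) − f_t(x) = L^*f_t(x)`,
  `P^*` = `timeReversal π P`) [cite: BobkovTetali2006, §2 Lemma 2.1];
* `bilinDirichletForm` (eq. (1.1)), `bilinDirichletForm_self`, `entropyDirichletForm_eq_half_add`,
  `bilinDirichletForm_log_eq_entropyDirichletForm` [cite: BobkovTetali2006, §1 eq. (1.1), Remark 2.6];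
* **EQ. (1.3)** `BobkovTetali2006_eq_1_3` and **THEOREM 2.2** `BobkovTetali2006_thm_2_2`
  (`Var_π(f_t) ≤ e^{−2λ₁t}Var_π(f_0)`, every initial law, every `t ≥ 0`; the two-time form
  `lawVariance_densityFlow_le` holds for all real `s ≤ t`) [cite: BobkovTetali2006, §2 eq. (1.3),
  Thm 2.2 eq. (2.1)];
* **LEMMA 2.3** `lawFlow_pos` (positivity for `t > 0` under irreducibility) and
  `BobkovTetali2006_lemma_2_3` (`(d/dt)D(μ_t‖π) = −𝓔(f_t, log f_t)` wherever `μ_t > 0`)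
  [cite: BobkovTetali2006, §2 Lemma 2.3, eq. (1.4)];
* **THEOREM 2.4** `BobkovTetali2006_thm_2_4` — for ANY constant `c` with `c·Ent_π(f) ≤ ½𝓔(f, log f)`
  for all positive `f` (inequality (1.5), general `P`), `D(μ_t‖π) ≤ e^{−2ct}D(μ_0‖π)` for `t ≥ 0`;
  `BobkovTetali2006_thm_2_4_modLogSobolevConst` — the reversible case with `c = ρ₀ = modLogSobolevConst π P`;
  `BobkovTetali2006_eq_2_3` — the reversible case with `c = 2α`, `α` the log-Sobolev constant
  ((2.3), via `2α ≤ ρ₀`) [cite: BobkovTetali2006, §2 Thm 2.4 eq. (2.2), Remark 2.5 eq. (2.3)];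
* **(2.4)** `BobkovTetali2006_eq_2_4` (`4·tvDist(μ_t,π)² ≤ (1/π_*)e^{−2λ₁t}`), **(2.5)**
  `BobkovTetali2006_eq_2_5` (Pinsker), **COROLLARY 2.8** `BobkovTetali2006_cor_2_8`
  (`4·tvDist(μ_t,π)² ≤ 2 log(1/π_*) e^{−2ρ₀t}`, reversible `P`) and the general-constant form
  `BobkovTetali2006_cor_2_8_of_mlsi` [cite: BobkovTetali2006, §2 eq. (2.4)–(2.6), Cor. 2.8; §1 eq. (1.6)].
The one-variable step "integrating this inequality over `t`" is `le_exp_mul_of_hasDerivAt_le` /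
`le_exp_mul_of_hasDerivAt_le_Ici` (`g' ≤ −cg ⇒ g(t) ≤ e^{−c(t−s)}g(s)`, by monotonicity of `e^{cu}g(u)`).
Everything is PROVED (finite sums and Mathlib's calculus; 0 named facts, 0 new kernels: the semigroup
is the tree's `heatKernel`).  `π_*` enters as any lower bound `0 < p ≤ π(x)` (the convention of
`relEnt_le_log_inv`).

Context (cell pub-lqcd, venture LatticeQCDFlow): the continuous-time (Poissonised) reading of a sampler's
entropy contraction — `ρ₀`, not the spectral gap alone, converts into a relative-entropy / total-variation
bound whose price for the starting point is `log log(1/π_*)`-like rather than `log(1/π_*)`, the quantity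
the cell's cost-versus-volume accounting compares across exact samplers.
-/

namespace Literature.Probability.MarkovChains

open Finset Matrix Filter Topology NormedSpace

variable {X : Type*} [Fintype X] [DecidableEq X]

/-! ## The semigroup `P_t = e^{−t(I−P)}` = the tree's `heatKernel P 1 t` -/

section Semigroup

open scoped Matrix.Norms.Operator

omit [Fintype X] in
/-- The generator at unit rate: `(P − I)(x,y) = P(x,y) − δ_{xy}` ("with the generator `−L = I − P`").
[cite: BobkovTetali2006, §2 (p. 293, `P_t = e^{−t(I−P)}`)] -/
theorem rateGenerator_one_apply (P : Matrix X X ℝ) (x y : X) :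
    rateGenerator P 1 x y = P x y - if x = y then 1 else 0 := by
  simp [rateGenerator, Matrix.one_apply]

/-- `P_0 = I`. [cite: BobkovTetali2006, §2 (p. 293)] -/
theorem heatKernel_time_zero (P : Matrix X X ℝ) (r : ℝ) : heatKernel P r 0 = 1 := by
  rw [heatKernel, zero_smul, exp_zero]

/-- The forward equation `(d/dt)P_t = P_t·r(P − I)` (Norris's Theorem 2.1.1 (ii) of the tree's
`KolmogorovEquations.lean`, for the matrix `r(P − I)`). [cite: BobkovTetali2006, §2 Lemma 2.1
(`dμ_t/dt = μ_tL`)] -/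
theorem hasDerivAt_heatKernel_forward (P : Matrix X X ℝ) (r t : ℝ) :
    HasDerivAt (fun u : ℝ => heatKernel P r u) (heatKernel P r t * rateGenerator P r) t :=
  Norris1997_thm_2_1_1_forward (rateGenerator P r) t

/-- The forward equation entrywise at unit rate: `(d/dt)P_t(x,y) = Σ_k P_t(x,k)P(k,y) − P_t(x,y)`.
[cite: BobkovTetali2006, §2 Lemma 2.1] -/
theorem hasDerivAt_heatKernel_apply_forward (P : Matrix X X ℝ) (t : ℝ) (x y : X) :
    HasDerivAt (fun u : ℝ => heatKernel P 1 u x y)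
      ((∑ k, heatKernel P 1 t x k * P k y) - heatKernel P 1 t x y) t := by
  have h := hasDerivAt_apply_of_hasDerivAt (hasDerivAt_heatKernel_forward P 1 t) x y
  refine h.congr_deriv ?_
  rw [Matrix.mul_apply]
  simp only [rateGenerator_one_apply, mul_sub, sum_sub_distrib, mul_ite, mul_one, mul_zero, sum_ite_eq',
    mem_univ, if_true]

/-- Under irreducibility ((c): "for all `x, y ∈ M`, there exists `n ≥ 1` with `Pⁿ(x,y) > 0`")
**every entry of `P_t` is positive for `t > 0`**: `P_t(x,y) ≥ e^{−t}tⁿ/n!·Pⁿ(x,y) > 0` by the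
expansion `P_t = e^{−t}Σ_n tⁿPⁿ/n!` (the tree's `heatKernel_apply_hasSum`). [cite: BobkovTetali2006,
§2 Lemma 2.3 (proof: "with the assumptions (b)–(c) we get `P_t^*(x,y) > 0` whenever `t > 0`")] -/
theorem heatKernel_pos {P : Matrix X X ℝ} (hP : IsRowStochastic P) (hirr : IsIrreducible P) {t : ℝ}
    (ht : 0 < t) (x y : X) : 0 < heatKernel P 1 t x y := by
  obtain ⟨n, hn⟩ := hirr x y
  have h1t : 0 < 1 * t := by rwa [one_mul]
  have hs := heatKernel_apply_hasSum P 1 t x y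
  have hle := le_hasSum hs n fun m _ =>
    mul_nonneg (Real.exp_pos _).le
      (mul_nonneg (div_nonneg (pow_nonneg h1t.le m) (Nat.cast_nonneg _))
        (Matrix.pow_apply_nonneg hP.1 m x y))
  refine lt_of_lt_of_le ?_ hle
  exact mul_pos (Real.exp_pos _)
    (mul_pos (div_pos (pow_pos h1t n) (Nat.cast_pos.2 (Nat.factorial_pos n))) hn)

end Semigroup

/-! ## The laws `μ_t = μ_0P_t` and the densities `f_t = μ_t/π`; Lemma 2.1 -/

/-- `μ_t = μ_0P_t`, the law of `X_t` ("Recall that `μ_t = μ_0P_t`"). [cite: BobkovTetali2006, §2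
(p. 293)] -/
noncomputable def lawFlow (P : Matrix X X ℝ) (μ₀ : X → ℝ) (t : ℝ) : X → ℝ :=
  stepLaw (heatKernel P 1 t) μ₀

/-- `f_t(x) = μ_t(x)/π(x)`, "the density of `μ_t` with respect to `π` at time `t ≥ 0`".
[cite: BobkovTetali2006, §2 (p. 293)] -/
noncomputable def densityFlow (P : Matrix X X ℝ) (π μ₀ : X → ℝ) (t : ℝ) : X → ℝ :=
  fun x => lawFlow P μ₀ t x / π x

/-- `μ_t(y) = Σ_x μ_0(x)P_t(x,y)`. [cite: BobkovTetali2006, §2 (p. 293)] -/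
theorem lawFlow_apply (P : Matrix X X ℝ) (μ₀ : X → ℝ) (t : ℝ) (y : X) :
    lawFlow P μ₀ t y = ∑ x, μ₀ x * heatKernel P 1 t x y := rfl

omit [Fintype X] [DecidableEq X] in
/-- `f_t(x) = μ_t(x)/π(x)`. [cite: BobkovTetali2006, §2 (p. 293)] -/
theorem densityFlow_apply [Fintype X] [DecidableEq X] (P : Matrix X X ℝ) (π μ₀ : X → ℝ) (t : ℝ)
    (x : X) : densityFlow P π μ₀ t x = lawFlow P μ₀ t x / π x := rfl

/-- `μ_0P_0 = μ_0`. [cite: BobkovTetali2006, §2 (p. 293)] -/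
theorem lawFlow_zero (P : Matrix X X ℝ) (μ₀ : X → ℝ) : lawFlow P μ₀ 0 = μ₀ := by
  funext y
  simp only [lawFlow_apply, heatKernel_time_zero, Matrix.one_apply, mul_ite, mul_one, mul_zero,
    sum_ite_eq', mem_univ, if_true]

/-- Mass is conserved: `Σ_y μ_t(y) = Σ_x μ_0(x)`. [cite: BobkovTetali2006, §2 (p. 293)] -/
theorem sum_lawFlow {P : Matrix X X ℝ} (hP : IsRowStochastic P) (μ₀ : X → ℝ) (t : ℝ) :
    ∑ y, lawFlow P μ₀ t y = ∑ x, μ₀ x := by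
  simp only [lawFlow_apply]
  rw [sum_comm]
  exact sum_congr rfl fun x _ => by rw [← mul_sum, sum_heatKernel hP 1 t x, mul_one]

/-- `μ_t ≥ 0` for `μ_0 ≥ 0`, `t ≥ 0`. [cite: BobkovTetali2006, §2 (p. 293)] -/
theorem lawFlow_nonneg {P : Matrix X X ℝ} (hP : IsRowStochastic P) {μ₀ : X → ℝ} (hμ0 : ∀ x, 0 ≤ μ₀ x)
    {t : ℝ} (ht : 0 ≤ t) (y : X) : 0 ≤ lawFlow P μ₀ t y :=
  sum_nonneg fun x _ => mul_nonneg (hμ0 x) (heatKernel_nonneg hP (by rwa [one_mul]) x y)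

/-- The stationary law does not move: `πP_t = π`. [cite: BobkovTetali2006, §2 assumption (a)] -/
theorem lawFlow_self {π : X → ℝ} {P : Matrix X X ℝ} (hst : IsStationary π P) (t : ℝ) :
    lawFlow P π t = π :=
  funext fun y => heatKernel_stationary hst 1 t y

/-- **LEMMA 2.3, first statement: "For any `μ_0` and all `t > 0`, the density `f_t` is strictly
positive on `M`"** (irreducible `P`, probability vector `μ_0`). [cite: BobkovTetali2006, §2 Lemma 2.3] -/
theorem lawFlow_pos {P : Matrix X X ℝ} (hP : IsRowStochastic P) (hirr : IsIrreducible P) {μ₀ : X → ℝ}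
    (hμ0 : ∀ x, 0 ≤ μ₀ x) (hμ1 : ∑ x, μ₀ x = 1) {t : ℝ} (ht : 0 < t) (y : X) :
    0 < lawFlow P μ₀ t y := by
  obtain ⟨x, hx⟩ : ∃ x, 0 < μ₀ x := by
    by_contra h
    push Not at h
    have h0 : ∑ x, μ₀ x = 0 := sum_eq_zero fun x _ => le_antisymm (h x) (hμ0 x)
    rw [hμ1] at h0
    exact one_ne_zero h0
  have ht' : 0 ≤ 1 * t := by rw [one_mul]; exact ht.le
  calc (0 : ℝ) < μ₀ x * heatKernel P 1 t x y := mul_pos hx (heatKernel_pos hP hirr ht x y)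
    _ ≤ ∑ z, μ₀ z * heatKernel P 1 t z y :=
        single_le_sum (f := fun z => μ₀ z * heatKernel P 1 t z y)
          (fun z _ => mul_nonneg (hμ0 z) (heatKernel_nonneg hP ht' z y)) (mem_univ x)

/-- `f_t > 0` for `t > 0` (irreducible `P`, `π > 0`). [cite: BobkovTetali2006, §2 Lemma 2.3] -/
theorem densityFlow_pos {π : X → ℝ} (hπ : ∀ x, 0 < π x) {P : Matrix X X ℝ} (hP : IsRowStochastic P)
    (hirr : IsIrreducible P) {μ₀ : X → ℝ} (hμ0 : ∀ x, 0 ≤ μ₀ x) (hμ1 : ∑ x, μ₀ x = 1) {t : ℝ}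
    (ht : 0 < t) (x : X) : 0 < densityFlow P π μ₀ t x :=
  div_pos (lawFlow_pos hP hirr hμ0 hμ1 ht x) (hπ x)

/-- **LEMMA 2.1 (law form)**: `t ↦ μ_t(y)` is differentiable with
`dμ_t(y)/dt = (μ_tP)(y) − μ_t(y) = (μ_tL)(y)` — the forward equation read on the row vector `μ_0P_t`.
[cite: BobkovTetali2006, §2 Lemma 2.1] -/
theorem hasDerivAt_lawFlow (P : Matrix X X ℝ) (μ₀ : X → ℝ) (t : ℝ) (y : X) :
    HasDerivAt (fun u => lawFlow P μ₀ u y)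
      (stepLaw P (lawFlow P μ₀ t) y - lawFlow P μ₀ t y) t := by
  have h : HasDerivAt (fun u => lawFlow P μ₀ u y)
      (∑ x, μ₀ x * ((∑ k, heatKernel P 1 t x k * P k y) - heatKernel P 1 t x y)) t :=
    HasDerivAt.fun_sum fun x _ => (hasDerivAt_heatKernel_apply_forward P t x y).const_mul (μ₀ x)
  refine h.congr_deriv ?_
  simp only [stepLaw, lawFlow_apply, mul_sub, sum_sub_distrib, mul_sum, sum_mul]
  congr 1
  rw [sum_comm]
  exact sum_congr rfl fun k _ => sum_congr rfl fun x _ => by ring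

/-- `t ↦ μ_t(y)` is continuous. [cite: BobkovTetali2006, §2 Lemma 2.1] -/
theorem continuous_lawFlow (P : Matrix X X ℝ) (μ₀ : X → ℝ) (y : X) :
    Continuous fun u => lawFlow P μ₀ u y :=
  continuous_iff_continuousAt.2 fun u => (hasDerivAt_lawFlow P μ₀ u y).continuousAt

omit [DecidableEq X] in
/-- `Σ_y dμ_t(y)/dt = 0` (unit row sums of `P`). [cite: BobkovTetali2006, §2 Lemma 2.1] -/
theorem sum_stepLaw_sub {P : Matrix X X ℝ} (hP : IsRowStochastic P) (μ : X → ℝ) :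
    ∑ y, (stepLaw P μ y - μ y) = 0 := by
  rw [sum_sub_distrib, sum_stepLaw hP, sub_self]

omit [DecidableEq X] in
/-- The generator pairing: `Σ_y g(y)((μP)(y) − μ(y)) = Σ_x μ(x)((Pg)(x) − g(x)) = E_μ[Lg]`.
[cite: BobkovTetali2006, §1 eq. (1.1) (`𝓔(f,g) = −E_π(f·Lg)`)] -/
theorem sum_mul_stepLaw_sub (P : Matrix X X ℝ) (μ g : X → ℝ) :
    ∑ y, g y * (stepLaw P μ y - μ y) = ∑ x, μ x * ((P *ᵥ g) x - g x) := by
  simp only [stepLaw, mulVec, dotProduct, mul_sub, sum_sub_distrib, mul_sum]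
  congr 1
  · rw [sum_comm]
    exact sum_congr rfl fun x _ => sum_congr rfl fun y _ => by ring
  · exact sum_congr rfl fun x _ => by ring

/-! ## The bilinear Dirichlet form (1.1) -/

/-- **Eq. (1.1)**: the (bilinear, in general non-symmetric) Dirichlet form `𝓔(f,g) = −E_π(f·Lg) =
−Σ_x f(x)Lg(x)π(x)`, `L = P − I`, i.e. `𝓔(f,g) = ⟨f,g⟩_π − ⟨f,Pg⟩_π`. [cite: BobkovTetali2006, §1
eq. (1.1)] -/
def bilinDirichletForm (π : X → ℝ) (P : Matrix X X ℝ) (f g : X → ℝ) : ℝ :=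
  piInner π f g - piInner π f (P *ᵥ g)

omit [DecidableEq X] in
/-- `𝓔(f,g) = ⟨f,g⟩_π − ⟨f,Pg⟩_π`. [cite: BobkovTetali2006, §1 eq. (1.1)] -/
theorem bilinDirichletForm_def (π : X → ℝ) (P : Matrix X X ℝ) (f g : X → ℝ) :
    bilinDirichletForm π P f g = piInner π f g - piInner π f (P *ᵥ g) := rfl

omit [DecidableEq X] in
/-- `𝓔(f,g) = −E_π(f·Lg) = −Σ_x π(x)f(x)((Pg)(x) − g(x))`. [cite: BobkovTetali2006, §1 eq. (1.1)] -/
theorem bilinDirichletForm_eq_neg_sum (π : X → ℝ) (P : Matrix X X ℝ) (f g : X → ℝ) :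
    bilinDirichletForm π P f g = -∑ x, π x * (f x * ((P *ᵥ g) x - g x)) := by
  rw [bilinDirichletForm_def, piInner, piInner, ← sum_neg_distrib, ← sum_sub_distrib]
  exact sum_congr rfl fun x _ => by ring

omit [DecidableEq X] in
/-- On the diagonal the bilinear form is the tree's Dirichlet form: `𝓔(f,f) = ⟨f,(I−P)f⟩_π =
½Σ_{x,y}π(x)P(x,y)(f(x) − f(y))²` (row-stochastic `P`, stationary `π`). [cite: BobkovTetali2006, §1
eq. (1.1)–(1.2) and Remark 2.6 (`𝓔_P(f,f) = 𝓔_{P̂}(f,f)`)] -/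
theorem bilinDirichletForm_self {π : X → ℝ} {P : Matrix X X ℝ} (hP : IsRowStochastic P)
    (hst : IsStationary π P) (f : X → ℝ) : bilinDirichletForm π P f f = dirichletForm π P f := by
  rw [bilinDirichletForm_def, dirichletForm_eq hP hst f]

/-- `E_π[g·f_t] = Σ_x μ_t(x)g(x)`. [cite: BobkovTetali2006, §2 (p. 293, `f_t = dμ_t/dπ`)] -/
theorem piInner_densityFlow {π : X → ℝ} (hπ : ∀ x, π x ≠ 0) (P : Matrix X X ℝ) (μ₀ : X → ℝ)
    (t : ℝ) (g : X → ℝ) : piInner π (densityFlow P π μ₀ t) g = ∑ x, lawFlow P μ₀ t x * g x := by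
  unfold piInner
  exact sum_congr rfl fun x _ => by
    have hx := hπ x
    rw [densityFlow_apply]
    field_simp

/-- With `μ_t = π·f_t`: `Σ_y g(y)·dμ_t(y)/dt = −𝓔(f_t, g)` — the step "`∫(log f_t + 1)L^*f_t dπ =
∫L(log f_t)f_t dπ = −𝓔(f_t, log f_t)`" for an arbitrary test function `g`.
[cite: BobkovTetali2006, §2 (proof of Lemma 2.3)] -/
theorem sum_mul_deriv_lawFlow {π : X → ℝ} (hπ : ∀ x, π x ≠ 0) (P : Matrix X X ℝ) (μ₀ : X → ℝ)
    (t : ℝ) (g : X → ℝ) :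
    ∑ y, g y * (stepLaw P (lawFlow P μ₀ t) y - lawFlow P μ₀ t y)
      = -bilinDirichletForm π P (densityFlow P π μ₀ t) g := by
  rw [sum_mul_stepLaw_sub, bilinDirichletForm_def, piInner_densityFlow hπ,
    piInner_densityFlow hπ, neg_sub, ← sum_sub_distrib]
  exact sum_congr rfl fun x _ => by ring

/-- `E_π f_t = Σ_x μ_0(x)` (`= 1` for a probability vector `μ_0`). [cite: BobkovTetali2006, §2 (p. 293)] -/
theorem lawMean_densityFlow {π : X → ℝ} (hπ : ∀ x, π x ≠ 0) {P : Matrix X X ℝ} (hP : IsRowStochastic P)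
    (μ₀ : X → ℝ) (t : ℝ) : lawMean π (densityFlow P π μ₀ t) = ∑ x, μ₀ x := by
  rw [lawMean, ← sum_lawFlow hP μ₀ t]
  exact sum_congr rfl fun x _ => by
    have hx := hπ x
    rw [densityFlow_apply]
    field_simp

/-- **LEMMA 2.1 (as printed)**: `df_t(x)/dt = L^*f_t(x) = (P^*f_t)(x) − f_t(x)`, where `P^*` is "the
time-reversal of `P` defined by the identity `π(x)P^*(x,y) = π(y)P(y,x)`" (the tree's `timeReversal π P`;
`(μ_tP)(x) = π(x)(P^*f_t)(x)` is `stepLaw_eq_mul_timeReversal_mulVec`). [cite: BobkovTetali2006, §2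
Lemma 2.1] -/
theorem BobkovTetali2006_lemma_2_1 {π : X → ℝ} (hπ : ∀ x, 0 < π x) (P : Matrix X X ℝ) (μ₀ : X → ℝ)
    (t : ℝ) (x : X) :
    HasDerivAt (fun u => densityFlow P π μ₀ u x)
      ((timeReversal π P *ᵥ densityFlow P π μ₀ t) x - densityFlow P π μ₀ t x) t := by
  have h : HasDerivAt (fun u => densityFlow P π μ₀ u x)
      ((stepLaw P (lawFlow P μ₀ t) x - lawFlow P μ₀ t x) / π x) t :=
    (hasDerivAt_lawFlow P μ₀ t x).div_const (π x)
  refine h.congr_deriv ?_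
  have hx : π x ≠ 0 := (hπ x).ne'
  have e : densityFlow P π μ₀ t = fun z => lawFlow P μ₀ t z / π z := rfl
  rw [sub_div, stepLaw_eq_mul_timeReversal_mulVec hπ P (lawFlow P μ₀ t) x, ← e, densityFlow_apply,
    mul_div_cancel_left₀ _ hx]

/-! ## "Integrating over `t`": `g' ≤ −cg ⇒ g(t) ≤ e^{−c(t−s)}g(s)` -/

omit [Fintype X] [DecidableEq X] in
/-- If `g' ≤ −cg` everywhere then `u ↦ e^{cu}g(u)` is non-increasing, so `g(t) ≤ e^{−c(t−s)}g(s)` for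
`s ≤ t` ("Integrating over `t`, one arrives at the standard estimate"). [cite: BobkovTetali2006, §2
(the sentence before Theorem 2.2)] -/
theorem le_exp_mul_of_hasDerivAt_le {g g' : ℝ → ℝ} {c : ℝ} (hg : ∀ u, HasDerivAt g (g' u) u)
    (hle : ∀ u, g' u ≤ -c * g u) {s t : ℝ} (hst : s ≤ t) :
    g t ≤ Real.exp (-c * (t - s)) * g s := by
  have hh : ∀ u, HasDerivAt (fun u => Real.exp (c * u) * g u)
      (Real.exp (c * u) * c * g u + Real.exp (c * u) * g' u) u := fun u => by
    have h0 : HasDerivAt (fun u : ℝ => c * u) c u := by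
      simpa using (hasDerivAt_id u).const_mul c
    exact h0.exp.mul (hg u)
  have hanti : Antitone fun u => Real.exp (c * u) * g u := by
    refine antitone_of_deriv_nonpos (fun u => (hh u).differentiableAt) fun u => ?_
    rw [(hh u).deriv]
    have h1 := hle u
    have h2 : Real.exp (c * u) * c * g u + Real.exp (c * u) * g' u
        = Real.exp (c * u) * (c * g u + g' u) := by ring
    rw [h2]
    exact mul_nonpos_of_nonneg_of_nonpos (Real.exp_pos _).le (by linarith)
  have h := hanti hst
  simp only at h
  calc g t = Real.exp (-(c * t)) * (Real.exp (c * t) * g t) := by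
        rw [← mul_assoc, ← Real.exp_add, neg_add_cancel, Real.exp_zero, one_mul]
    _ ≤ Real.exp (-(c * t)) * (Real.exp (c * s) * g s) :=
        mul_le_mul_of_nonneg_left h (Real.exp_pos _).le
    _ = Real.exp (-c * (t - s)) * g s := by
        rw [← mul_assoc, ← Real.exp_add]
        congr 1
        ring_nf

omit [Fintype X] [DecidableEq X] in
/-- The same on the half-line: `g` continuous on `[0,∞)`, differentiable on `(0,∞)` with `g' ≤ −cg`
there, gives `g(t) ≤ e^{−c(t−s)}g(s)` for `0 ≤ s ≤ t` ("Integrating this inequality over `t` and since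
the right hand side is continuous at `t = 0`"). [cite: BobkovTetali2006, §2 (the sentence before
Theorem 2.4)] -/
theorem le_exp_mul_of_hasDerivAt_le_Ici {g g' : ℝ → ℝ} {c : ℝ} (hcont : ContinuousOn g (Set.Ici 0))
    (hg : ∀ u, 0 < u → HasDerivAt g (g' u) u) (hle : ∀ u, 0 < u → g' u ≤ -c * g u) {s t : ℝ}
    (hs : 0 ≤ s) (hst : s ≤ t) : g t ≤ Real.exp (-c * (t - s)) * g s := by
  have hh : ∀ u, 0 < u → HasDerivAt (fun u => Real.exp (c * u) * g u)
      (Real.exp (c * u) * c * g u + Real.exp (c * u) * g' u) u := fun u hu => by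
    have h0 : HasDerivAt (fun u : ℝ => c * u) c u := by
      simpa using (hasDerivAt_id u).const_mul c
    exact h0.exp.mul (hg u hu)
  have hanti : AntitoneOn (fun u => Real.exp (c * u) * g u) (Set.Ici 0) := by
    refine antitoneOn_of_deriv_nonpos (convex_Ici 0) ?_ ?_ ?_
    · exact ((Real.continuous_exp.comp (continuous_const.mul continuous_id)).continuousOn).mul hcont
    · rw [interior_Ici]
      exact fun u hu => (hh u hu).differentiableAt.differentiableWithinAt
    · rw [interior_Ici]
      intro u hu
      rw [(hh u hu).deriv]
      have h1 := hle u hu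
      have h2 : Real.exp (c * u) * c * g u + Real.exp (c * u) * g' u
          = Real.exp (c * u) * (c * g u + g' u) := by ring
      rw [h2]
      exact mul_nonpos_of_nonneg_of_nonpos (Real.exp_pos _).le (by linarith)
  have h := hanti (Set.mem_Ici.2 hs) (Set.mem_Ici.2 (hs.trans hst)) hst
  simp only at h
  calc g t = Real.exp (-(c * t)) * (Real.exp (c * t) * g t) := by
        rw [← mul_assoc, ← Real.exp_add, neg_add_cancel, Real.exp_zero, one_mul]
    _ ≤ Real.exp (-(c * t)) * (Real.exp (c * s) * g s) :=
        mul_le_mul_of_nonneg_left h (Real.exp_pos _).le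
    _ = Real.exp (-c * (t - s)) * g s := by
        rw [← mul_assoc, ← Real.exp_add]
        congr 1
        ring_nf

/-! ## Eq. (1.3) and Theorem 2.2: decay of the variance -/

/-- **EQ. (1.3)**: `(d/dt)Var_π(f_t) = −2𝓔(f_t,f_t)` ("differentiating the function `Var_π(f_t) =
∫f_t² dπ − 1`, we get `… = 2∫f_tL^*f_t dπ = 2∫L(f_t)f_t dπ = −2𝓔(f_t,f_t)`"); every real `t`,
any initial vector `μ_0`. [cite: BobkovTetali2006, §1 eq. (1.3), §2 (display before Theorem 2.2)] -/
theorem BobkovTetali2006_eq_1_3 {π : X → ℝ} (hπ : ∀ x, 0 < π x) {P : Matrix X X ℝ}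
    (hP : IsRowStochastic P) (hst : IsStationary π P) (μ₀ : X → ℝ) (t : ℝ) :
    HasDerivAt (fun u => lawVariance π (densityFlow P π μ₀ u))
      (-2 * dirichletForm π P (densityFlow P π μ₀ t)) t := by
  have hπ' : ∀ x, π x ≠ 0 := fun x => (hπ x).ne'
  set m := ∑ x, μ₀ x with hm
  have hfun : (fun u => lawVariance π (densityFlow P π μ₀ u))
      = fun u => ∑ x, π x * (densityFlow P π μ₀ u x - m) ^ 2 := by
    funext u
    rw [lawVariance, lawMean_densityFlow hπ' hP μ₀ u]
  rw [hfun]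
  have hD : ∀ y, HasDerivAt (fun u => densityFlow P π μ₀ u y)
      ((stepLaw P (lawFlow P μ₀ t) y - lawFlow P μ₀ t y) / π y) t := fun y =>
    (hasDerivAt_lawFlow P μ₀ t y).div_const (π y)
  have h := HasDerivAt.fun_sum fun y (_ : y ∈ (univ : Finset X)) =>
    (((hD y).sub_const m).fun_pow 2).const_mul (π y)
  refine h.congr_deriv ?_
  have e1 : ∀ y, π y * (((2 : ℕ) : ℝ) * (densityFlow P π μ₀ t y - m) ^ (2 - 1)
      * ((stepLaw P (lawFlow P μ₀ t) y - lawFlow P μ₀ t y) / π y))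
      = 2 * (densityFlow P π μ₀ t y * (stepLaw P (lawFlow P μ₀ t) y - lawFlow P μ₀ t y))
        - 2 * m * (stepLaw P (lawFlow P μ₀ t) y - lawFlow P μ₀ t y) := fun y => by
    have hx := hπ' y
    simp only [Nat.cast_ofNat, show (2 : ℕ) - 1 = 1 from rfl, pow_one]
    field_simp
  simp_rw [e1]
  rw [sum_sub_distrib, ← mul_sum, ← mul_sum, sum_mul_deriv_lawFlow hπ' P μ₀ t,
    sum_stepLaw_sub hP, bilinDirichletForm_self hP hst]
  ring

/-- **THEOREM 2.2, two-time form**: `Var_π(f_t) ≤ e^{−2λ₁(t−s)}Var_π(f_s)` for all real `s ≤ t`,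
`λ₁ = spectralGapR π P` (from (1.3) and (1.2) `λ₁Var_π(f) ≤ 𝓔(f,f)`). [cite: BobkovTetali2006, §2
Thm 2.2] -/
theorem lawVariance_densityFlow_le {π : X → ℝ} (hπ : ∀ x, 0 < π x) (hπ1 : ∑ x, π x = 1)
    {P : Matrix X X ℝ} (hP : IsRowStochastic P) (hst : IsStationary π P) (μ₀ : X → ℝ) {s t : ℝ}
    (hst' : s ≤ t) :
    lawVariance π (densityFlow P π μ₀ t)
      ≤ Real.exp (-(2 * spectralGapR π P) * (t - s)) * lawVariance π (densityFlow P π μ₀ s) :=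
  le_exp_mul_of_hasDerivAt_le (g := fun u => lawVariance π (densityFlow P π μ₀ u))
    (fun u => BobkovTetali2006_eq_1_3 hπ hP hst μ₀ u)
    (fun u => by
      have h := spectralGapR_mul_lawVariance_le' (fun x => (hπ x).le) hπ1 hP.1 (densityFlow P π μ₀ u)
      linarith)
    hst'

/-- **THEOREM 2.2**: "For every initial distribution `μ_0`, `Var_π(f_t) ≤ Var_π(f_0)e^{−2λ₁t}`,
`t ≥ 0`" (`λ₁ = spectralGapR π P`, the optimal constant of the Poincaré-type inequality (1.2)).
[cite: BobkovTetali2006, §2 Thm 2.2 eq. (2.1)] -/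
theorem BobkovTetali2006_thm_2_2 {π : X → ℝ} (hπ : ∀ x, 0 < π x) (hπ1 : ∑ x, π x = 1)
    {P : Matrix X X ℝ} (hP : IsRowStochastic P) (hst : IsStationary π P) (μ₀ : X → ℝ) {t : ℝ}
    (ht : 0 ≤ t) :
    lawVariance π (densityFlow P π μ₀ t)
      ≤ Real.exp (-(2 * spectralGapR π P) * t) * lawVariance π (densityFlow P π μ₀ 0) := by
  have h := lawVariance_densityFlow_le hπ hπ1 hP hst μ₀ ht
  rwa [sub_zero] at h

/-! ## Lemma 2.3 and Theorem 2.4: decay of the informational divergence -/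

/-- `Ent_π(f_t) = D(μ_t‖π)` for a probability vector `μ_0` ("`D(μ_t‖π) = Ent_π(f_t) = ∫f_t log f_t dπ`").
[cite: BobkovTetali2006, §2 (p. 293)] -/
theorem piEnt_densityFlow {π : X → ℝ} (hπ : ∀ x, 0 < π x) {P : Matrix X X ℝ} (hP : IsRowStochastic P)
    {μ₀ : X → ℝ} (hμ1 : ∑ x, μ₀ x = 1) (t : ℝ) :
    piEnt π (densityFlow P π μ₀ t) = relEnt (lawFlow P μ₀ t) π := by
  have hπ' : ∀ x, π x ≠ 0 := fun x => (hπ x).ne'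
  unfold piEnt relEnt
  have hmass : ∑ x, π x * densityFlow P π μ₀ t x = 1 := by
    rw [← hμ1, ← sum_lawFlow hP μ₀ t]
    exact sum_congr rfl fun x _ => by
      have hx := hπ' x
      rw [densityFlow_apply]
      field_simp
  rw [hmass, Real.log_one, mul_zero, sub_zero]
  exact sum_congr rfl fun x _ => by
    have hx := hπ' x
    rw [densityFlow_apply]
    field_simp

/-- `t ↦ D(μ_t‖π)` is continuous on `ℝ` (finitely many continuous terms `u ↦ u log(u/π(x))`).
[cite: BobkovTetali2006, §2 Lemma 2.3 ("the right hand side is continuous at `t = 0`")] -/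
theorem continuous_relEnt_lawFlow {π : X → ℝ} (hπ : ∀ x, π x ≠ 0) (P : Matrix X X ℝ) (μ₀ : X → ℝ) :
    Continuous fun u => relEnt (lawFlow P μ₀ u) π := by
  unfold relEnt
  refine continuous_finsetSum _ fun x _ => ?_
  have hφ : Continuous fun v : ℝ => v * Real.log (v / π x) := by
    have e : (fun v : ℝ => v * Real.log (v / π x)) = fun v => v * Real.log v - v * Real.log (π x) := by
      funext v
      rcases eq_or_ne v 0 with hv | hv
      · simp [hv]
      · rw [Real.log_div hv (hπ x)]; ring
    rw [e]
    exact Real.continuous_mul_log.sub (continuous_id.mul continuous_const)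
  exact hφ.comp (continuous_lawFlow P μ₀ x)

/-- **LEMMA 2.3 / EQ. (1.4)**: wherever `μ_t > 0`, `t ↦ D(μ_t‖π)` is differentiable and
`(d/dt)D(μ_t‖π) = −𝓔(f_t, log f_t)` ("`= ∫(log f_t + 1)L^*f_t dπ = ∫L(log f_t)f_t dπ = −𝓔(f_t, log f_t)`"),
`𝓔` the bilinear form (1.1); no reversibility assumed. [cite: BobkovTetali2006, §2 Lemma 2.3, §1 eq. (1.4)] -/
theorem BobkovTetali2006_lemma_2_3 {π : X → ℝ} (hπ : ∀ x, 0 < π x) {P : Matrix X X ℝ}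
    (hP : IsRowStochastic P) {μ₀ : X → ℝ} {t : ℝ} (hpos : ∀ x, 0 < lawFlow P μ₀ t x) :
    HasDerivAt (fun u => relEnt (lawFlow P μ₀ u) π)
      (-bilinDirichletForm π P (densityFlow P π μ₀ t)
        (fun x => Real.log (densityFlow P π μ₀ t x))) t := by
  have hπ' : ∀ x, π x ≠ 0 := fun x => (hπ x).ne'
  have hterm : ∀ y, HasDerivAt (fun u => lawFlow P μ₀ u y * Real.log (lawFlow P μ₀ u y / π y))
      ((Real.log (densityFlow P π μ₀ t y) + 1) * (stepLaw P (lawFlow P μ₀ t) y - lawFlow P μ₀ t y)) t :=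
    fun y => by
    have hμ : HasDerivAt (fun u => lawFlow P μ₀ u y) (stepLaw P (lawFlow P μ₀ t) y - lawFlow P μ₀ t y) t :=
      hasDerivAt_lawFlow P μ₀ t y
    have hl : HasDerivAt (fun u => Real.log (lawFlow P μ₀ u y / π y))
        (((stepLaw P (lawFlow P μ₀ t) y - lawFlow P μ₀ t y) / π y) / (lawFlow P μ₀ t y / π y)) t :=
      (hμ.div_const (π y)).log (div_pos (hpos y) (hπ y)).ne'
    have h := hμ.fun_mul hl
    refine h.congr_deriv ?_
    have hx := hπ' y
    have hm := (hpos y).ne'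
    rw [densityFlow_apply]
    field_simp
  have h := HasDerivAt.fun_sum fun y (_ : y ∈ (univ : Finset X)) => hterm y
  unfold relEnt
  refine h.congr_deriv ?_
  simp_rw [add_mul, one_mul, sum_add_distrib]
  rw [sum_stepLaw_sub hP, add_zero, sum_mul_deriv_lawFlow hπ' P μ₀ t]

/-- **THEOREM 2.4 (general form, no reversibility: Remark 2.5)**: if a constant `c` satisfies the
modified logarithmic Sobolev inequality (1.5) `c·Ent_π(f) ≤ ½𝓔(f, log f)` for every positive `f`
(`𝓔` the bilinear form (1.1)), then for every initial distribution `μ_0` and all `t ≥ 0`,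
**`D(μ_t‖π) ≤ D(μ_0‖π)e^{−2ct}`** — "By Lemma 2.3, `(d/dt)D(μ_t‖π) ≤ −2ρ₀D(μ_t‖π)`, for all `t > 0`.
Integrating this inequality over `t` and since the right hand side is continuous at `t = 0`".
Hypotheses (b)–(c) of the paper: `π` positive, `P` irreducible (stationarity is not needed for this
step). [cite: BobkovTetali2006, §2 Thm 2.4 eq. (2.2), Remark 2.5] -/
theorem BobkovTetali2006_thm_2_4 {π : X → ℝ} (hπ : ∀ x, 0 < π x)
    {P : Matrix X X ℝ} (hP : IsRowStochastic P) (hirr : IsIrreducible P) {c : ℝ}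
    (hc : ∀ f : X → ℝ, (∀ x, 0 < f x) →
      c * piEnt π f ≤ bilinDirichletForm π P f (fun x => Real.log (f x)) / 2)
    {μ₀ : X → ℝ} (hμ0 : ∀ x, 0 ≤ μ₀ x) (hμ1 : ∑ x, μ₀ x = 1) {t : ℝ} (ht : 0 ≤ t) :
    relEnt (lawFlow P μ₀ t) π ≤ Real.exp (-(2 * c) * t) * relEnt μ₀ π := by
  have hπ' : ∀ x, π x ≠ 0 := fun x => (hπ x).ne'
  have h := le_exp_mul_of_hasDerivAt_le_Ici (g := fun u => relEnt (lawFlow P μ₀ u) π) (c := 2 * c)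
    (g' := fun u => -bilinDirichletForm π P (densityFlow P π μ₀ u)
      (fun x => Real.log (densityFlow P π μ₀ u x)))
    (continuous_relEnt_lawFlow hπ' P μ₀).continuousOn
    (fun u hu => BobkovTetali2006_lemma_2_3 hπ hP (lawFlow_pos hP hirr hμ0 hμ1 hu))
    (fun u hu => by
      have h1 := hc (densityFlow P π μ₀ u) (densityFlow_pos hπ hP hirr hμ0 hμ1 hu)
      rw [piEnt_densityFlow hπ hP hμ1 u] at h1
      linarith)
    le_rfl ht
  simpa only [sub_zero, lawFlow_zero] using h

/-! ## The reversible case: `𝓔(f, log f)` is the symmetric form, Theorem 2.4 with `ρ₀` and with `2α` -/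

omit [DecidableEq X] in
/-- `Σ_{x,y}π(x)P(x,y)(f(x) − f(y))(l(x) − l(y)) = 𝓔(f,l) + 𝓔(l,f)` — the SYMMETRIC entropy form of
`ModifiedLogSobolevConstant.lean` is the average of the two bilinear forms (1.1) (row-stochastic `P`,
stationary `π`; no reversibility). [cite: BobkovTetali2006, Remark 2.6 ("there is something inherently
reversible about `𝓔(f,f)` … `𝓔_P(f,f) = 𝓔_{P̂}(f,f)` with `P̂ = ½(P + P^*)`")] -/
theorem entropyDirichletForm_eq_half_add {π : X → ℝ} {P : Matrix X X ℝ} (hP : IsRowStochastic P)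
    (hst : IsStationary π P) (f : X → ℝ) :
    entropyDirichletForm π P f
      = (bilinDirichletForm π P f (fun x => Real.log (f x))
          + bilinDirichletForm π P (fun x => Real.log (f x)) f) / 2 := by
  set l : X → ℝ := fun x => Real.log (f x) with hl
  have hT1 : ∑ x, ∑ y, π x * P x y * (f x * l x) = piInner π f l := by
    unfold piInner
    exact sum_congr rfl fun x _ => by rw [← sum_mul, ← mul_sum, hP.2 x, mul_one]
  have hT4 : ∑ x, ∑ y, π x * P x y * (f y * l y) = piInner π f l := by
    unfold piInner
    rw [sum_comm]
    exact sum_congr rfl fun y _ => by rw [← sum_mul, hst y]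
  have hT2 : ∑ x, ∑ y, π x * P x y * (f x * l y) = piInner π f (P *ᵥ l) := by
    unfold piInner
    simp only [mulVec, dotProduct, mul_sum]
    exact sum_congr rfl fun x _ => sum_congr rfl fun y _ => by ring
  have hT3 : ∑ x, ∑ y, π x * P x y * (f y * l x) = piInner π l (P *ᵥ f) := by
    unfold piInner
    simp only [mulVec, dotProduct, mul_sum]
    exact sum_congr rfl fun x _ => sum_congr rfl fun y _ => by ring
  have hexp : ∀ x y, π x * P x y * ((f x - f y) * (Real.log (f x) - Real.log (f y)))
      = π x * P x y * (f x * l x) - π x * P x y * (f x * l y) - π x * P x y * (f y * l x)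
        + π x * P x y * (f y * l y) := fun x y => by simp only [hl]; ring
  unfold entropyDirichletForm
  simp_rw [hexp, sum_add_distrib, sum_sub_distrib, hT1, hT2, hT3, hT4]
  rw [bilinDirichletForm_def, bilinDirichletForm_def, piInner_comm π l f]
  ring

omit [DecidableEq X] in
/-- For a REVERSIBLE `P` the two bilinear forms agree on `(f, log f)` ("`⟨Pg,h⟩_π = ⟨g,Ph⟩_π`"), so the
paper's `𝓔(f, log f)` is the tree's symmetric `entropyDirichletForm π P f`. [cite: BobkovTetali2006, §1
(setting: "an ergodic, reversible Markov chain") and §3 ("If `P` is a reversible Markov kernel, then the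
above definition is also equivalent to the general definition given by (1.1)")] -/
theorem bilinDirichletForm_log_eq_entropyDirichletForm {π : X → ℝ} {P : Matrix X X ℝ}
    (hP : IsRowStochastic P) (hDB : DetailedBalance π P) (f : X → ℝ) :
    bilinDirichletForm π P f (fun x => Real.log (f x)) = entropyDirichletForm π P f := by
  have hst : IsStationary π P := hDB.isStationary hP.2
  have hsymm : bilinDirichletForm π P (fun x => Real.log (f x)) f
      = bilinDirichletForm π P f (fun x => Real.log (f x)) := by
    rw [bilinDirichletForm_def, bilinDirichletForm_def, piInner_comm π (fun x => Real.log (f x)) f,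
      piInner_comm π (fun x => Real.log (f x)) (P *ᵥ f), piInner_mulVec_comm hDB]
  rw [entropyDirichletForm_eq_half_add hP hst f, hsymm]
  ring

/-- **THEOREM 2.4 (reversible `P`, the optimal constant)**: `D(μ_t‖π) ≤ D(μ_0‖π)e^{−2ρ₀t}` for all
`t ≥ 0` and every initial distribution, `ρ₀ = modLogSobolevConst π P` the modified logarithmic Sobolev
constant of (1.5)/(3.3). [cite: BobkovTetali2006, §2 Thm 2.4 eq. (2.2)] -/
theorem BobkovTetali2006_thm_2_4_modLogSobolevConst {π : X → ℝ} (hπ : ∀ x, 0 < π x)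
    (hπ1 : ∑ x, π x = 1) {P : Matrix X X ℝ} (hP : IsRowStochastic P) (hDB : DetailedBalance π P)
    (hirr : IsIrreducible P) {μ₀ : X → ℝ} (hμ0 : ∀ x, 0 ≤ μ₀ x) (hμ1 : ∑ x, μ₀ x = 1) {t : ℝ}
    (ht : 0 ≤ t) :
    relEnt (lawFlow P μ₀ t) π
      ≤ Real.exp (-(2 * modLogSobolevConst π P) * t) * relEnt μ₀ π :=
  BobkovTetali2006_thm_2_4 hπ hP hirr
    (fun f hf => by
      rw [bilinDirichletForm_log_eq_entropyDirichletForm hP hDB f]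
      exact modLogSobolevConst_mul_piEnt_le hπ hπ1 hP.1 hf)
    hμ0 hμ1 ht

/-- **EQ. (2.3)** (Bakry, Stroock, Diaconis–Saloff-Coste, as recalled in Remark 2.5):
`D(μ_t‖π) ≤ D(μ_0‖π)e^{−2ρt}` with `ρ` the log-Sobolev constant of (1.7) `ρEnt_π(f²) ≤ 2𝓔(f,f)` —
`ρ = 2α` for the tree's `α = logSobolevConst π P` — for a reversible irreducible `P` on at least two
points; obtained here, as in the paper, from Theorem 2.4 and `ρ ≤ ρ₀` (Proposition 3.6,
`two_mul_logSobolevConst_le_modLogSobolevConst`). [cite: BobkovTetali2006, §2 Remark 2.5 eq. (2.3)] -/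
theorem BobkovTetali2006_eq_2_3 [Nontrivial X] {π : X → ℝ} (hπ : ∀ x, 0 < π x)
    (hπ1 : ∑ x, π x = 1) {P : Matrix X X ℝ} (hP : IsRowStochastic P) (hDB : DetailedBalance π P)
    (hirr : IsIrreducible P) {μ₀ : X → ℝ} (hμ0 : ∀ x, 0 ≤ μ₀ x) (hμ1 : ∑ x, μ₀ x = 1) {t : ℝ}
    (ht : 0 ≤ t) :
    relEnt (lawFlow P μ₀ t) π
      ≤ Real.exp (-(2 * (2 * logSobolevConst π P)) * t) * relEnt μ₀ π := by
  have h := BobkovTetali2006_thm_2_4_modLogSobolevConst hπ hπ1 hP hDB hirr hμ0 hμ1 ht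
  have hρ := two_mul_logSobolevConst_le_modLogSobolevConst hπ hπ1 hP.1
  have hD : 0 ≤ relEnt μ₀ π := relEnt_nonneg hμ0 hπ (by rw [hμ1, hπ1])
  refine h.trans (mul_le_mul_of_nonneg_right (Real.exp_le_exp.2 ?_) hD)
  nlinarith

/-! ## Total variation: (2.4), (2.5) and Corollary 2.8 -/

omit [DecidableEq X] in
/-- "one can use the bound `‖μ_t − π‖²_TV ⩽ Var_π(f_t)`" (Cauchy–Schwarz; the paper's norm is
`Σ_x|μ(x) − π(x)| = 2·tvDist μ π`): `4·tvDist(μ,π)² ≤ Var_π(μ/π)` for a unit-mass `μ` and a probability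
vector `π > 0`. [cite: BobkovTetali2006, §2 (sentence before eq. (2.4))] -/
theorem four_mul_tvDist_sq_le_lawVariance {π : X → ℝ} (hπ : ∀ x, 0 < π x) (hπ1 : ∑ x, π x = 1)
    {μ : X → ℝ} (hμ1 : ∑ x, μ x = 1) :
    4 * tvDist μ π ^ 2 ≤ lawVariance π (fun x => μ x / π x) := by
  have hπ' : ∀ x, π x ≠ 0 := fun x => (hπ x).ne'
  have hmean : lawMean π (fun x => μ x / π x) = 1 := by
    rw [lawMean, ← hμ1]
    exact sum_congr rfl fun x _ => by
      have hx := hπ' x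
      field_simp
  have htv : 2 * tvDist μ π = ∑ x, Real.sqrt (π x) * (Real.sqrt (π x) * |μ x / π x - 1|) := by
    rw [tvDist, ← mul_assoc, show (2 : ℝ) * (1 / 2) = 1 by norm_num, one_mul]
    refine sum_congr rfl fun x _ => ?_
    rw [← mul_assoc, Real.mul_self_sqrt (hπ x).le, ← abs_of_pos (hπ x), ← abs_mul, abs_of_pos (hπ x)]
    have hx := hπ' x
    congr 1
    field_simp
  have hcs := sum_mul_sq_le_sq_mul_sq (univ : Finset X) (fun x => Real.sqrt (π x))
    (fun x => Real.sqrt (π x) * |μ x / π x - 1|)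
  have h1 : ∑ x, Real.sqrt (π x) ^ 2 = 1 := by
    rw [← hπ1]; exact sum_congr rfl fun x _ => Real.sq_sqrt (hπ x).le
  have h2 : ∑ x, (Real.sqrt (π x) * |μ x / π x - 1|) ^ 2 = lawVariance π (fun x => μ x / π x) := by
    rw [lawVariance, hmean]
    exact sum_congr rfl fun x _ => by rw [mul_pow, Real.sq_sqrt (hπ x).le, sq_abs]
  rw [← htv, h1, one_mul, h2] at hcs
  calc 4 * tvDist μ π ^ 2 = (2 * tvDist μ π) ^ 2 := by ring
    _ ≤ _ := hcs

omit [DecidableEq X] in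
/-- `Var_π(f_0) ≤ 1/π_*` for the density of a probability vector ("The right hand side of (2.1) is
maximized when `μ_0` is one of the Dirac measures `δ_x`", where `Var_π(δ_x/π) = 1/π(x) − 1`).
[cite: BobkovTetali2006, §2 (derivation of eq. (2.4))] -/
theorem lawVariance_density_le {π : X → ℝ} (hπ : ∀ x, 0 < π x) (hπ1 : ∑ x, π x = 1) {μ : X → ℝ}
    (hμ0 : ∀ x, 0 ≤ μ x) (hμ1 : ∑ x, μ x = 1) {c : ℝ} (hc : 0 < c) (hπc : ∀ x, c ≤ π x) :
    lawVariance π (fun x => μ x / π x) ≤ 1 / c := by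
  have hπ' : ∀ x, π x ≠ 0 := fun x => (hπ x).ne'
  have hmean : lawMean π (fun x => μ x / π x) = 1 := by
    rw [lawMean, ← hμ1]
    exact sum_congr rfl fun x _ => by
      have hx := hπ' x
      field_simp
  have hμle : ∀ x, μ x ≤ 1 := fun x => by
    rw [← hμ1]; exact single_le_sum (f := μ) (fun y _ => hμ0 y) (mem_univ x)
  have hsq : ∑ x, π x * (μ x / π x) ^ 2 ≤ 1 / c := by
    calc ∑ x, π x * (μ x / π x) ^ 2 = ∑ x, μ x * (μ x / π x) := sum_congr rfl fun x _ => by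
            have hx := hπ' x
            field_simp
        _ ≤ ∑ x, μ x * (1 / c) := sum_le_sum fun x _ => mul_le_mul_of_nonneg_left (by
            rw [div_le_div_iff₀ (hπ x) hc, one_mul]
            exact (mul_le_of_le_one_left hc.le (hμle x)).trans (hπc x)) (hμ0 x)
        _ = 1 / c := by rw [← sum_mul, hμ1, one_mul]
  have hexp : lawVariance π (fun x => μ x / π x) = ∑ x, π x * (μ x / π x) ^ 2 - 1 := by
    rw [lawVariance, hmean]
    have e : ∀ x, π x * (μ x / π x - 1) ^ 2 = π x * (μ x / π x) ^ 2 - 2 * μ x + π x := fun x => by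
      have hx := hπ' x
      field_simp
      ring
    simp_rw [e, sum_add_distrib, sum_sub_distrib, ← mul_sum, hμ1, hπ1]
    ring
  rw [hexp]
  linarith

/-- **EQ. (2.4)**: `‖μ_t − π‖²_TV ≤ (1/π_*)e^{−2λ₁t}` "uniformly over all possible `μ_0`" — here
`4·tvDist(μ_t,π)² ≤ (1/π_*)e^{−2λ₁t}` with `tvDist = ½Σ|·|`, `π_*` any positive lower bound of `π`.
[cite: BobkovTetali2006, §2 eq. (2.4)] -/
theorem BobkovTetali2006_eq_2_4 {π : X → ℝ} (hπ : ∀ x, 0 < π x) (hπ1 : ∑ x, π x = 1)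
    {P : Matrix X X ℝ} (hP : IsRowStochastic P) (hst : IsStationary π P) {μ₀ : X → ℝ}
    (hμ0 : ∀ x, 0 ≤ μ₀ x) (hμ1 : ∑ x, μ₀ x = 1) {p : ℝ} (hp : 0 < p) (hπp : ∀ x, p ≤ π x) {t : ℝ}
    (ht : 0 ≤ t) :
    4 * tvDist (lawFlow P μ₀ t) π ^ 2 ≤ 1 / p * Real.exp (-(2 * spectralGapR π P) * t) := by
  have hmass : ∑ x, lawFlow P μ₀ t x = 1 := by rw [sum_lawFlow hP, hμ1]
  calc 4 * tvDist (lawFlow P μ₀ t) π ^ 2 ≤ lawVariance π (densityFlow P π μ₀ t) :=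
        four_mul_tvDist_sq_le_lawVariance hπ hπ1 hmass
    _ ≤ Real.exp (-(2 * spectralGapR π P) * t) * lawVariance π (densityFlow P π μ₀ 0) :=
        BobkovTetali2006_thm_2_2 hπ hπ1 hP hst μ₀ ht
    _ ≤ Real.exp (-(2 * spectralGapR π P) * t) * (1 / p) := by
        refine mul_le_mul_of_nonneg_left ?_ (Real.exp_pos _).le
        have e : densityFlow P π μ₀ 0 = fun x => μ₀ x / π x :=
          funext fun x => by rw [densityFlow_apply, lawFlow_zero]
        rw [e]
        exact lawVariance_density_le hπ hπ1 hμ0 hμ1 hp hπp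
    _ = 1 / p * Real.exp (-(2 * spectralGapR π P) * t) := mul_comm _ _

/-- **EQ. (2.5)** "for every probability measure `μ` on `M`, `‖μ − π‖²_TV ≤ 2D(μ‖π)`" — in the tree's
normalisation `4·tvDist(μ,π)² ≤ 2D(μ‖π)`, i.e. Pinsker (`two_mul_tvDist_sq_le_relEnt`).
[cite: BobkovTetali2006, §2 eq. (2.5)] -/
theorem BobkovTetali2006_eq_2_5 {π : X → ℝ} (hπ : ∀ x, 0 < π x) (hπ1 : ∑ x, π x = 1) {μ : X → ℝ}
    (hμ0 : ∀ x, 0 ≤ μ x) (hμ1 : ∑ x, μ x = 1) : 4 * tvDist μ π ^ 2 ≤ 2 * relEnt μ π := by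
  have h := two_mul_tvDist_sq_le_relEnt hμ0 hμ1 hπ hπ1
  linarith

/-- **COROLLARY 2.8 (general constant)**: under (1.5) with constant `c` (bilinear form (1.1), any
irreducible `P`, `π > 0`), `‖μ_t − π‖²_TV ≤ 2 log(1/π_*) e^{−2ct}`, here as
`4·tvDist(μ_t,π)² ≤ 2 log(1/π_*) e^{−2ct}`. [cite: BobkovTetali2006, §2 Cor. 2.8 eq. (2.6); §1 eq. (1.6)] -/
theorem BobkovTetali2006_cor_2_8_of_mlsi {π : X → ℝ} (hπ : ∀ x, 0 < π x) (hπ1 : ∑ x, π x = 1)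
    {P : Matrix X X ℝ} (hP : IsRowStochastic P) (hirr : IsIrreducible P) {c : ℝ}
    (hc : ∀ f : X → ℝ, (∀ x, 0 < f x) →
      c * piEnt π f ≤ bilinDirichletForm π P f (fun x => Real.log (f x)) / 2)
    {μ₀ : X → ℝ} (hμ0 : ∀ x, 0 ≤ μ₀ x) (hμ1 : ∑ x, μ₀ x = 1) {p : ℝ} (hp : 0 < p)
    (hπp : ∀ x, p ≤ π x) {t : ℝ} (ht : 0 ≤ t) :
    4 * tvDist (lawFlow P μ₀ t) π ^ 2 ≤ 2 * Real.log (1 / p) * Real.exp (-(2 * c) * t) := by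
  have hmass : ∑ x, lawFlow P μ₀ t x = 1 := by rw [sum_lawFlow hP, hμ1]
  have h1 := BobkovTetali2006_eq_2_5 hπ hπ1 (lawFlow_nonneg hP hμ0 ht) hmass
  have h2 := BobkovTetali2006_thm_2_4 hπ hP hirr hc hμ0 hμ1 ht
  have h3 := relEnt_le_log_inv hμ0 hμ1 hp hπp
  have h4 : Real.exp (-(2 * c) * t) * relEnt μ₀ π ≤ Real.exp (-(2 * c) * t) * Real.log (1 / p) :=
    mul_le_mul_of_nonneg_left h3 (Real.exp_pos _).le
  linarith

/-- **COROLLARY 2.8**: "For every initial distribution `μ_0` on `M`, for all `t ≥ 0`,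
`‖μ_t − π‖²_TV ≤ 2 log(1/π_*) e^{−2ρ₀t}`" — reversible irreducible `P`, `ρ₀ = modLogSobolevConst π P`,
in the tree's normalisation `4·tvDist(μ_t,π)² ≤ 2 log(1/π_*) e^{−2ρ₀t}` (= eq. (1.6)).
[cite: BobkovTetali2006, §2 Cor. 2.8 eq. (2.6); §1 eq. (1.6)] -/
theorem BobkovTetali2006_cor_2_8 {π : X → ℝ} (hπ : ∀ x, 0 < π x) (hπ1 : ∑ x, π x = 1)
    {P : Matrix X X ℝ} (hP : IsRowStochastic P) (hDB : DetailedBalance π P) (hirr : IsIrreducible P)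
    {μ₀ : X → ℝ} (hμ0 : ∀ x, 0 ≤ μ₀ x) (hμ1 : ∑ x, μ₀ x = 1) {p : ℝ} (hp : 0 < p)
    (hπp : ∀ x, p ≤ π x) {t : ℝ} (ht : 0 ≤ t) :
    4 * tvDist (lawFlow P μ₀ t) π ^ 2
      ≤ 2 * Real.log (1 / p) * Real.exp (-(2 * modLogSobolevConst π P) * t) :=
  BobkovTetali2006_cor_2_8_of_mlsi hπ hπ1 hP hirr
    (fun f hf => by
      rw [bilinDirichletForm_log_eq_entropyDirichletForm hP hDB f]
      exact modLogSobolevConst_mul_piEnt_le hπ hπ1 hP.1 hf)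
    hμ0 hμ1 hp hπp ht

end Literature.Probability.MarkovChains
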